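import Literature.NumberTheory.Automorphic.UnitaryLatticeTreePeriodTransfer       -- ★ (this seat) FILE 1: the three per-level transfers `natCard_quotient_orbitRel_fixedBy_{glInt,conj_glInt,inf}_eq_rankN`; brings FILE ★ `UnitaryLatticeTreeFixedCosetFlags`
import Literature.NumberTheory.Automorphic.UnitaryLatticeTreeApartmentAction       -- ★ (F0P2-p02 (g10)) `latticeGraphIso_apartment_{selfDual,two}_translate` (the torus translates its apartment); brings ★ `…ApartmentTorus`, ★ `…Apartment` (`mapGL_coe_latt_eq`, `diagonal_three_mul`, `L_a`, `L′_a`)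
import Literature.NumberTheory.Automorphic.UnitaryLatticeTreeApartmentPath         -- ★ (F0P2-p02) `latticeGraph_adj_apartment_two_selfDual`, `latticeGraph_adj_apartment_selfDual_two_succ`, `latt_diagonal_le_latt_diagonal_iff`, `v_zpow_le_v_zpow_iff`
import Literature.NumberTheory.Automorphic.UnitaryLatticeTreeStar                  -- ★ (B-p14) `not_isSelfDualLattice_of_isVertexLattice_two`; brings ★ `…TypeTwoTransitive` (`isTree_latticeGraph_three_of_unramified`, `forall_isVertexLattice_two_exists_mapGL_N₁_eq`)
import Literature.NumberTheory.Automorphic.UnitaryLatticeTreeSelfDualTransitiveOfTrace  -- ★ (B-p14) `exists_unitary_mapGL_stdLattice_eq_of_isSelfDualLattice_of_trace`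
import Literature.NumberTheory.Automorphic.UnitaryLatticeTreeRootStarOrbit         -- ★ (B-p14) `exists_mem_unitaryInt_eq_mapGL_N₁_of_lt`, `mapGL_N₁_lt_stdLattice`
import Literature.Combinatorics.SimpleGraph.TreeActionLinePerPeriod                -- ★ (this seat) TREE SIDE: `exists_line_of_two_step`, `zpow_smul_line`, `natCard_quotient_fixed_vertices_eq_fixed_edges_of_line_of_exists`; brings ★ `OrbitQuotientTubeCount`
import HarnessLib

/-!
# Kottwitz's NON-ELLIPTIC relation per period on the `U(3)` lattice tree: `#(Fix_γ(U⧸K₀)∕τ^ℤ) + #(Fix_γ(U⧸K₁)∕τ^ℤ) = #(Fix_γ(U⧸(K₀ ⊓ K₁))∕τ^ℤ)`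
# for a DIAGONAL `γ` and the translation `τ = diag(ϖ⁻¹, 1, ϖ)` of the quasi-split unitary group of `J₀ = antidiag(1,1,1)` (Kottwitz 1988 §2 Thm. 2; Serre, *Trees* I.6.4)

Topic `NumberTheory/Automorphic`; namespace `Literature.NumberTheory.Automorphic.UnitaryLatticeTree`.  THEOREMS ONLY (no definition ∕ instance ∕ notation ∕ named fact ∕ `sorry`).
Cell `pub/hodgecm-mathlib`, crux H413 = `stmt-HodgeConjecture-24833` (`--supports` lane, helper), LH6 rung-0 residue, CENSUS «EP-G» v1 (F0P3a-p09) §5 brick (G1) «(N)-G», COSET SIDE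
FILE 2 of 2 (FILE 1 = ★ `UnitaryLatticeTreePeriodTransfer`; TREE SIDE = ★ `TreeActionLinePerPeriod`).  Seat LH6-p03 (g8).  The rank-2 twin is ★ `HermitianLatticeTreePeriodDictionary.
natCard_quotient_fixedBy_add_eq_natCard_quotient_fixedBy_inf` (B-p04 (g35)).  HONEST LABEL: count-neutral orbit counting (nothing printed is asserted); HC_CM is proved only modulo the 7
printed citations (2 remaining named inputs hLiu418 = stmt-HodgeConjecture-24832, h413 = stmt-HodgeConjecture-24833) until rung 0 closes.

THE THEOREM (`natCard_quotient_fixedBy_add_eq_natCard_quotient_fixedBy_inf_three`).  `K` a field with `Valued K ℤᵐ⁰` and the compatible `ValuativeRel`, an unramified datum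
`hd : UnramifiedLocalConjDatum σ ϖ`, `J₀ = antidiag(1,1,1)`, `U = unitaryGroupOfForm σ J₀`, `K₀ = (glInt 3 K).subgroupOf U`, `g₁ = diag(1,1,ϖ)`, `K₁ = ((glInt 3 K).map (conj g₁)).subgroupOf U`
(★ `UnitaryLatticeTreeFixedCosetFlags`' spelling); `τ ∈ U` with matrix `diag(ϖ⁻¹, 1, ϖ)` (a generator of the diagonal torus modulo its compact part; it translates the apartment
`… L_a — L′_a — L_{a−1} — …` by TWO edges, `L_a = latt diag(ϖ^a,1,ϖ^{−a})`, `L′_a = latt diag(ϖ^a,1,ϖ^{1−a})`), `γ ∈ U` DIAGONAL with `|γ₀₀| = |ϖ^c|`, `|γ₁₁| = 1`, `|γ₂₂| = |ϖ^{−c}|` for some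
`c ∈ ℤ` (every regular element with non-compact centraliser is conjugate to such a `γ`; `c = 0` is the compact part of the torus), `τγ = γτ`.  If the per-period fixed-coset counts at
`K₀` and `K₁` are finite (★ `classOrbitalIntegral_indicator_eq_mul_natCard_quotient_zpowers` gives this for a closed class), then
`#(Fix_γ(U⧸K₀)∕τ^ℤ) + #(Fix_γ(U⧸K₁)∕τ^ℤ) = #(Fix_γ(U⧸(K₀ ⊓ K₁))∕τ^ℤ)` in the currency `Nat.card (Quotient ((orbitRel (zpowers ⟨τ, _⟩ : Subgroup Z_U(γ)) (U ⧸ C)).comap Subtype.val))`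
of ★ `classOrbitalIntegral_indicator_complex_eq_mul_natCard_quotient_zpowers` (`ν(C)⁻¹ Φ(⟦γ⟧, 𝟙_C) = #(Fix_γ(U⧸C)∕τ^ℤ)`) — i.e. the `hN` binder of ★ GLUE
`RankOneEulerPoincareGlue.exists_isLocSmooth_classOrbitalIntegral_eq_one_zero_of_relations` after the per-period engine, for Kottwitz's `f_EP^G` of the quasi-split `U(3)`.
PROOF.  COSET → TREE per level (★ FILE 1); the apartment is the two-step line `W (2n) = τⁿ·L₀`, `W (2n+1) = τⁿ·N₁` (★ `exists_line_of_two_step`), `γ` translates it by `−2c`, so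
★ `natCard_quotient_fixed_vertices_eq_fixed_edges_of_line_of_exists` gives «fixed vertices = pointwise-fixed edges» per period; the fixed vertices split by type (★ union count) and the
pointwise-fixed edges are the fixed flags (★ `type_of_lt_three`), equivariantly.
* §1 `commute_of_coe_eq_diagonal_three` (diagonal elements of `U` commute), `mapGL_latt_apartment_selfDual_of_diagonal` ∕ `…_two_of_diagonal` (a diagonal element with valuation profile
  `(|ϖ^c|, 1, |ϖ^{−c}|)` shifts `L_a ↦ L_{a+c}`, `L′_a ↦ L′_{a+c}` — common generalisation of ★ `mapGL_latt_apartment_*_of_units` (`c = 0`) and `…_translate`).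
* §2 **`natCard_quotient_fixedBy_add_eq_natCard_quotient_fixedBy_inf_three`** (the relation).

## References
* [Kottwitz1988] R. E. Kottwitz, *Tamagawa numbers*, Ann. of Math. 127 (1988), 629–646, §2 Theorem 2 (non-elliptic case).
* [Serre1980Trees] J.-P. Serre, *Trees* (1980), Ch. I §6.4 Prop. 24–25 (hyperbolic automorphisms, axis), Ch. II §1.1.
* [Laumon1995] G. Laumon, *Cohomology of Drinfeld Modular Varieties* I (1996), Lemma (5.3.2).
* [BruhatTits1972] F. Bruhat, J. Tits, *Groupes réductifs sur un corps local I*, Publ. IHÉS 41 (1972), §10 (the apartment of a split torus of a unitary group).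
* [Tits1979] J. Tits, *Reductive groups over local fields*, PSPM 33.1 (1979), §2.4 (the quasi-split `²A₂`).
-/

set_option autoImplicit false

noncomputable section

open Matrix MulAction SimpleGraph Literature.NumberTheory.Automorphic Literature.Combinatorics.SimpleGraph Literature.GroupTheory
open Literature.NumberTheory.Automorphic.HermitianLattice Literature.NumberTheory.Automorphic.UnitaryGroup Literature.NumberTheory.Automorphic.CartanUnique
open scoped Matrix MatrixGroups WithZero Valued Pointwise

namespace Literature.NumberTheory.Automorphic.UnitaryLatticeTree

variable {K : Type*} [Field K] [Valued K ℤᵐ⁰] [ValuativeRel K] [(Valued.v : Valuation K ℤᵐ⁰).Compatible]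

/-! ## §1 Diagonal elements: commutation and the shift of the apartment -/

section Diagonal

variable {σ : K →+* K} {ϖ : K}

omit [Valued K ℤᵐ⁰] [ValuativeRel K] [(Valued.v : Valuation K ℤᵐ⁰).Compatible] in
/-- Diagonal elements of `U(σ, H)` commute. [cite: Serre1980Trees, II.1.1] -/
theorem commute_of_coe_eq_diagonal_three {H : Matrix (Fin 3) (Fin 3) K} {t γ : ↥(unitaryGroupOfForm σ H)} {d e : Fin 3 → K}
    (ht : ((t : GL (Fin 3) K) : Matrix (Fin 3) (Fin 3) K) = Matrix.diagonal d) (hγ : ((γ : GL (Fin 3) K) : Matrix (Fin 3) (Fin 3) K) = Matrix.diagonal e) :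
    t * γ = γ * t := by
  apply Subtype.ext
  apply Units.ext
  change ((t : GL (Fin 3) K) : Matrix (Fin 3) (Fin 3) K) * ((γ : GL (Fin 3) K) : Matrix (Fin 3) (Fin 3) K) =
    ((γ : GL (Fin 3) K) : Matrix (Fin 3) (Fin 3) K) * ((t : GL (Fin 3) K) : Matrix (Fin 3) (Fin 3) K)
  rw [ht, hγ, Matrix.diagonal_mul_diagonal, Matrix.diagonal_mul_diagonal]
  congr 1
  funext i
  exact mul_comm _ _

omit [ValuativeRel K] [(Valued.v : Valuation K ℤᵐ⁰).Compatible] in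
/-- **A diagonal element of valuation profile `(|ϖ^c|, 1, |ϖ^{−c}|)` shifts the self-dual apartment vertices: `γ · L_a = L_{a+c}`** (`L_a = latt diag(ϖ^a, 1, ϖ^{−a})`; `c = 0` is ★
`mapGL_latt_apartment_selfDual_of_units`, `γ = t_c` is ★ `…_translate`). [cite: BruhatTits1972, §10] [cite: Serre1980Trees, I.6.4] -/
theorem mapGL_latt_apartment_selfDual_of_diagonal (hϖ : Valued.v ϖ = WithZero.exp (-1 : ℤ)) {H : Matrix (Fin 3) (Fin 3) K} (γ : ↥(unitaryGroupOfForm σ H))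
    {e : Fin 3 → K} (hγ : ((γ : GL (Fin 3) K) : Matrix (Fin 3) (Fin 3) K) = Matrix.diagonal e) {c : ℤ}
    (he₀ : Valued.v (e 0) = Valued.v (ϖ ^ c)) (he₁ : Valued.v (e 1) = 1) (he₂ : Valued.v (e 2) = Valued.v (ϖ ^ (-c))) (a : ℤ) :
    mapGL (γ : GL (Fin 3) K) (latt (Matrix.diagonal ![ϖ ^ a, (1 : K), ϖ ^ (-a)])) = latt (Matrix.diagonal ![ϖ ^ (a + c), (1 : K), ϖ ^ (-(a + c))]) := by
  have hϖ0 : ϖ ≠ 0 := uniformizer_ne_zero hϖ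
  have hvϖ : ∀ m : ℤ, Valued.v (ϖ ^ m) ≠ 0 := fun m => by rw [map_zpow₀]; exact zpow_ne_zero _ ((Valuation.ne_zero_iff _).2 hϖ0)
  have he0 : e 0 ≠ 0 := fun h0 => hvϖ c (by rw [← he₀, h0, map_zero])
  have he1 : e 1 ≠ 0 := fun h0 => zero_ne_one (by rw [← he₁, h0, map_zero])
  have he2 : e 2 ≠ 0 := fun h0 => hvϖ (-c) (by rw [← he₂, h0, map_zero])
  rw [mapGL_coe_latt_eq γ hγ, show (Matrix.diagonal e : Matrix (Fin 3) (Fin 3) K) = Matrix.diagonal ![e 0, e 1, e 2] by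
    congr 1; funext i; fin_cases i <;> rfl, diagonal_three_mul]
  refine latt_diagonal_congr (fun i => ?_) (fun i => ?_)
  · fin_cases i
    · exact mul_ne_zero he0 (zpow_ne_zero _ hϖ0)
    · exact mul_ne_zero he1 one_ne_zero
    · exact mul_ne_zero he2 (zpow_ne_zero _ hϖ0)
  · fin_cases i
    · change Valued.v (e 0 * ϖ ^ a) = Valued.v (ϖ ^ (a + c))
      rw [map_mul, he₀, ← map_mul, ← zpow_add₀ hϖ0, add_comm]
    · change Valued.v (e 1 * 1) = Valued.v (1 : K)
      rw [mul_one, he₁, map_one]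
    · change Valued.v (e 2 * ϖ ^ (-a)) = Valued.v (ϖ ^ (-(a + c)))
      rw [map_mul, he₂, ← map_mul, ← zpow_add₀ hϖ0, neg_add, add_comm]

omit [ValuativeRel K] [(Valued.v : Valuation K ℤᵐ⁰).Compatible] in
/-- **The same diagonal element shifts the type-two apartment vertices: `γ · L′_a = L′_{a+c}`** (`L′_a = latt diag(ϖ^a, 1, ϖ^{1−a})`). [cite: BruhatTits1972, §10] [cite: Serre1980Trees, I.6.4] -/
theorem mapGL_latt_apartment_two_of_diagonal (hϖ : Valued.v ϖ = WithZero.exp (-1 : ℤ)) {H : Matrix (Fin 3) (Fin 3) K} (γ : ↥(unitaryGroupOfForm σ H))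
    {e : Fin 3 → K} (hγ : ((γ : GL (Fin 3) K) : Matrix (Fin 3) (Fin 3) K) = Matrix.diagonal e) {c : ℤ}
    (he₀ : Valued.v (e 0) = Valued.v (ϖ ^ c)) (he₁ : Valued.v (e 1) = 1) (he₂ : Valued.v (e 2) = Valued.v (ϖ ^ (-c))) (a : ℤ) :
    mapGL (γ : GL (Fin 3) K) (latt (Matrix.diagonal ![ϖ ^ a, (1 : K), ϖ ^ (1 - a)])) = latt (Matrix.diagonal ![ϖ ^ (a + c), (1 : K), ϖ ^ (1 - (a + c))]) := by
  have hϖ0 : ϖ ≠ 0 := uniformizer_ne_zero hϖ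
  have hvϖ : ∀ m : ℤ, Valued.v (ϖ ^ m) ≠ 0 := fun m => by rw [map_zpow₀]; exact zpow_ne_zero _ ((Valuation.ne_zero_iff _).2 hϖ0)
  have he0 : e 0 ≠ 0 := fun h0 => hvϖ c (by rw [← he₀, h0, map_zero])
  have he1 : e 1 ≠ 0 := fun h0 => zero_ne_one (by rw [← he₁, h0, map_zero])
  have he2 : e 2 ≠ 0 := fun h0 => hvϖ (-c) (by rw [← he₂, h0, map_zero])
  rw [mapGL_coe_latt_eq γ hγ, show (Matrix.diagonal e : Matrix (Fin 3) (Fin 3) K) = Matrix.diagonal ![e 0, e 1, e 2] by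
    congr 1; funext i; fin_cases i <;> rfl, diagonal_three_mul]
  refine latt_diagonal_congr (fun i => ?_) (fun i => ?_)
  · fin_cases i
    · exact mul_ne_zero he0 (zpow_ne_zero _ hϖ0)
    · exact mul_ne_zero he1 one_ne_zero
    · exact mul_ne_zero he2 (zpow_ne_zero _ hϖ0)
  · fin_cases i
    · change Valued.v (e 0 * ϖ ^ a) = Valued.v (ϖ ^ (a + c))
      rw [map_mul, he₀, ← map_mul, ← zpow_add₀ hϖ0, add_comm]
    · change Valued.v (e 1 * 1) = Valued.v (1 : K)
      rw [mul_one, he₁, map_one]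
    · change Valued.v (e 2 * ϖ ^ (1 - a)) = Valued.v (ϖ ^ (1 - (a + c)))
      rw [map_mul, he₂, ← map_mul, ← zpow_add₀ hϖ0]
      congr 2
      ring

end Diagonal

/-! ## §2 The per-period relation on the `U(3)` tree -/

section Relation

variable {σ : K →+* K} {ϖ : K}

set_option maxHeartbeats 400000 in
-- the statement carries six large coset-quotient types and the proof threads three equivariant dictionaries (measured: > 200 000, < 400 000 heartbeats)
/-- **KOTTWITZ'S NON-ELLIPTIC RELATION PER PERIOD ON THE `U(3)` TREE, ON ANY MODEL `eU : G ≃* U(σ, J₀)`.**  `hd : UnramifiedLocalConjDatum σ ϖ`, levels `CA, CB, CI ≤ G` given by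
MEMBERSHIP through `eU` (`CA ↔ GL₃(𝒪)`, `CB ↔ g₁ GL₃(𝒪) g₁⁻¹`, `g₁ = diag(1,1,ϖ)`, `CI ↔` both — the `K₀, K₁, K₀ ⊓ K₁` of ★ `UnitaryLatticeTreeFixedCosetFlags` read in `G`); `τ ∈ G` with `eU τ = diag(ϖ⁻¹, 1, ϖ)`,
`γ ∈ G` with `eU γ` diagonal of valuation profile `(|ϖ^c|, 1, |ϖ^{−c}|)`, `τγ = γτ`; the per-period fixed-coset counts at `CA` and `CB` finite.  Then
`#(Fix_γ(G⧸CA)∕τ^ℤ) + #(Fix_γ(G⧸CB)∕τ^ℤ) = #(Fix_γ(G⧸CI)∕τ^ℤ)` — vertices of each type minus edges of the `γ`-fixed forest, per period of the translation, vanish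
(the `hN` binder of ★ `RankOneEulerPoincareGlue` after ★ `classOrbitalIntegral_indicator_complex_eq_mul_natCard_quotient_zpowers`).
[cite: Kottwitz1988, §2 Theorem 2] [cite: Serre1980Trees, I.6.4 Prop. 24–25; II.1.1] [cite: Laumon1995, Lemma (5.3.2)] [cite: BruhatTits1972, §10] [cite: Tits1979, §2.4] -/
theorem natCard_quotient_fixedBy_add_eq_natCard_quotient_fixedBy_inf_three (hd : UnramifiedLocalConjDatum σ ϖ)
    (g₁ : GL (Fin 3) K) (hg₁ : (g₁ : Matrix (Fin 3) (Fin 3) K) = Matrix.diagonal ![(1 : K), 1, ϖ])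
    {G : Type*} [Group G] (eU : G ≃* ↥(unitaryGroupOfForm σ ((StdForm.antidiagonal 3).over K))) (CA CB CI : Subgroup G)
    (hCA : ∀ g : G, g ∈ CA ↔ ((eU g : ↥(unitaryGroupOfForm σ ((StdForm.antidiagonal 3).over K))) : GL (Fin 3) K) ∈ glInt 3 K)
    (hCB : ∀ g : G, g ∈ CB ↔ ((eU g : ↥(unitaryGroupOfForm σ ((StdForm.antidiagonal 3).over K))) : GL (Fin 3) K) ∈ (glInt 3 K).map (MulAut.conj g₁).toMonoidHom)
    (hCI : ∀ g : G, g ∈ CI ↔ ((eU g : ↥(unitaryGroupOfForm σ ((StdForm.antidiagonal 3).over K))) : GL (Fin 3) K) ∈ glInt 3 K ∧ ((eU g : ↥(unitaryGroupOfForm σ ((StdForm.antidiagonal 3).over K))) : GL (Fin 3) K) ∈ (glInt 3 K).map (MulAut.conj g₁).toMonoidHom)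
    (τ γ : G) (hτm : (((eU τ : ↥(unitaryGroupOfForm σ ((StdForm.antidiagonal 3).over K))) : GL (Fin 3) K) : Matrix (Fin 3) (Fin 3) K) = Matrix.diagonal ![ϖ⁻¹, 1, ϖ])
    {e : Fin 3 → K} (hγm : (((eU γ : ↥(unitaryGroupOfForm σ ((StdForm.antidiagonal 3).over K))) : GL (Fin 3) K) : Matrix (Fin 3) (Fin 3) K) = Matrix.diagonal e) {c : ℤ}
    (he₀ : Valued.v (e 0) = Valued.v (ϖ ^ c)) (he₁ : Valued.v (e 1) = 1) (he₂ : Valued.v (e 2) = Valued.v (ϖ ^ (-c))) (hτγ : τ * γ = γ * τ)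
    (hfinA : Finite (Quotient ((orbitRel (Subgroup.zpowers (⟨τ, Subgroup.mem_centralizer_singleton_iff.2 hτγ⟩ : Subgroup.centralizer ({γ} : Set G))) (G ⧸ CA)).comap
        (Subtype.val : ↥(fixedBy (G ⧸ CA) γ) → G ⧸ CA))))
    (hfinB : Finite (Quotient ((orbitRel (Subgroup.zpowers (⟨τ, Subgroup.mem_centralizer_singleton_iff.2 hτγ⟩ : Subgroup.centralizer ({γ} : Set G))) (G ⧸ CB)).comap
        (Subtype.val : ↥(fixedBy (G ⧸ CB) γ) → G ⧸ CB)))) :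
    Nat.card (Quotient ((orbitRel (Subgroup.zpowers (⟨τ, Subgroup.mem_centralizer_singleton_iff.2 hτγ⟩ : Subgroup.centralizer ({γ} : Set G))) (G ⧸ CA)).comap
        (Subtype.val : ↥(fixedBy (G ⧸ CA) γ) → G ⧸ CA))) +
      Nat.card (Quotient ((orbitRel (Subgroup.zpowers (⟨τ, Subgroup.mem_centralizer_singleton_iff.2 hτγ⟩ : Subgroup.centralizer ({γ} : Set G))) (G ⧸ CB)).comap
        (Subtype.val : ↥(fixedBy (G ⧸ CB) γ) → G ⧸ CB))) =
    Nat.card (Quotient ((orbitRel (Subgroup.zpowers (⟨τ, Subgroup.mem_centralizer_singleton_iff.2 hτγ⟩ : Subgroup.centralizer ({γ} : Set G))) (G ⧸ CI)).comap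
        (Subtype.val : ↥(fixedBy (G ⧸ CI) γ) → G ⧸ CI))) := by
  classical
  have hϖ0 : ϖ ≠ 0 := uniformizer_ne_zero hd.vϖ
  have hϖ1 : Valued.v ϖ ≤ 1 := uniformizer_mem_integer hd.vϖ
  -- the root, the base edge, the three transitivities (as in ★ `UnitaryLatticeTreeEulerRelation`)
  have hroot : IsSelfDualLattice σ ϖ ((StdForm.antidiagonal 3).over K) (stdLattice K 3) := isSelfDualLattice_stdLattice_three hd
  have hnot : ∀ M : Submodule (Valued.integer K) (Fin 3 → K), IsVertexLattice σ ϖ ((StdForm.antidiagonal 3).over K) 2 M →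
      ¬ IsSelfDualLattice σ ϖ ((StdForm.antidiagonal 3).over K) M := fun M h2 => not_isSelfDualLattice_of_isVertexLattice_two hd h2
  have hN₁ : mapGL g₁ (stdLattice K 3) = latt (Matrix.diagonal ![(1 : K), 1, ϖ]) := by rw [← hg₁]; rfl
  have hg₁2 : IsVertexLattice σ ϖ ((StdForm.antidiagonal 3).over K) 2 (mapGL g₁ (stdLattice K 3)) := by
    rw [hN₁]; exact isVertexLattice_two_latt_diagonal_one_one hd.σϖ hϖ1 hϖ0
  have hlt₁ : mapGL g₁ (stdLattice K 3) < stdLattice K 3 := by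
    have h := mapGL_N₁_lt_stdLattice hd (Subgroup.one_mem (unitaryInt σ ((StdForm.antidiagonal 3).over K)))
    rwa [Subgroup.coe_one, mapGL_one, ← hN₁] at h
  have hA : ∀ M : Submodule (Valued.integer K) (Fin 3 → K), IsSelfDualLattice σ ϖ ((StdForm.antidiagonal 3).over K) M →
      ∃ u : ↥(unitaryGroupOfForm σ ((StdForm.antidiagonal 3).over K)), mapGL (u : GL (Fin 3) K) (stdLattice K 3) = M := fun M hM =>
    exists_unitary_mapGL_stdLattice_eq_of_isSelfDualLattice_of_trace hd.σσ hd.vσ hd.vϖ hd.trace hM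
  have hB : ∀ M : Submodule (Valued.integer K) (Fin 3 → K), IsVertexLattice σ ϖ ((StdForm.antidiagonal 3).over K) 2 M →
      ∃ u : ↥(unitaryGroupOfForm σ ((StdForm.antidiagonal 3).over K)), mapGL ((u : GL (Fin 3) K) * g₁) (stdLattice K 3) = M := by
    intro M hM
    obtain ⟨u, hu⟩ := forall_isVertexLattice_two_exists_mapGL_N₁_eq hd M hM
    exact ⟨u, by rw [mapGL_mul, hN₁, hu]⟩
  have hI : ∀ L M : Submodule (Valued.integer K) (Fin 3 → K), IsSelfDualLattice σ ϖ ((StdForm.antidiagonal 3).over K) L →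
      IsVertexLattice σ ϖ ((StdForm.antidiagonal 3).over K) 2 M → M < L →
      ∃ u : ↥(unitaryGroupOfForm σ ((StdForm.antidiagonal 3).over K)), mapGL (u : GL (Fin 3) K) (stdLattice K 3) = L ∧ mapGL ((u : GL (Fin 3) K) * g₁) (stdLattice K 3) = M := by
    intro L M hL hM hlt
    obtain ⟨u₀, hu₀⟩ := hA L hL
    have hM' : IsVertexLattice σ ϖ ((StdForm.antidiagonal 3).over K) 2 (mapGL ((u₀⁻¹ : ↥(unitaryGroupOfForm σ ((StdForm.antidiagonal 3).over K))) : GL (Fin 3) K) M) :=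
      isVertexLattice_mapGL σ ϖ _ _ (u₀⁻¹).2 hM
    have hlt' : mapGL ((u₀⁻¹ : ↥(unitaryGroupOfForm σ ((StdForm.antidiagonal 3).over K))) : GL (Fin 3) K) M < stdLattice K 3 := by
      have h := (mapGL_lt_mapGL_iff ((u₀⁻¹ : ↥(unitaryGroupOfForm σ ((StdForm.antidiagonal 3).over K))) : GL (Fin 3) K) _ _).2 hlt
      rwa [← hu₀, ← mapGL_mul, Subgroup.coe_inv, inv_mul_cancel, mapGL_one] at h
    obtain ⟨κ, hκ, hκM⟩ := exists_mem_unitaryInt_eq_mapGL_N₁_of_lt hd hM' hlt'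
    refine ⟨u₀ * κ, ?_, ?_⟩
    · rw [Subgroup.coe_mul, mapGL_mul, mapGL_stdLattice_of_mem_unitaryInt hκ, hu₀]
    · rw [Subgroup.coe_mul, mapGL_mul, mapGL_mul, hN₁, ← hκM, ← mapGL_mul, Subgroup.coe_inv, mul_inv_cancel, mapGL_one]
  -- COSET → TREE, level by level (★ FILE 1)
  obtain ⟨hAeq, hAfin⟩ := natCard_quotient_orbitRel_fixedBy_glInt_eq_rankN σ ϖ _ eU hroot hA CA hCA γ τ hτγ
  obtain ⟨hBeq, hBfin⟩ := natCard_quotient_orbitRel_fixedBy_conj_glInt_eq_rankN σ ϖ _ eU hg₁2 hB CB hCB γ τ hτγ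
  obtain ⟨hIeq, -⟩ := natCard_quotient_orbitRel_fixedBy_inf_eq_rankN σ ϖ _ eU hroot hg₁2 hlt₁ hI CI hCI γ τ hτγ
  have hτγ' : eU τ * eU γ = eU γ * eU τ := by rw [← map_mul, hτγ, map_mul]
  rw [hAeq, hBeq, hIeq]
  have hfinA' := hAfin.1 hfinA
  have hfinB' := hBfin.1 hfinB
  clear hAeq hBeq hIeq hAfin hBfin
  /- THE TREE SIDE.  Notation: `V` the vertices, `pτ`, `pγ` the permutations, `Φ = ⟨pτ⟩`. -/
  set V := {M : Submodule (Valued.integer K) (Fin 3 → K) // IsVertex σ ϖ ((StdForm.antidiagonal 3).over K) M} with hV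
  set pτ : Equiv.Perm V := latticeGraphPerm σ ϖ ((StdForm.antidiagonal 3).over K) (eU τ) with hpτ
  set pγ : Equiv.Perm V := latticeGraphPerm σ ϖ ((StdForm.antidiagonal 3).over K) (eU γ) with hpγ
  set Φ : Subgroup (Equiv.Perm V) := Subgroup.zpowers pτ with hΦ
  let τΦ : ↥Φ := ⟨pτ, Subgroup.mem_zpowers pτ⟩
  have hτΦcoe : ∀ n : ℤ, ((τΦ ^ n : ↥Φ) : Equiv.Perm V) = pτ ^ n := fun n => by rw [SubgroupClass.coe_zpow]
  have hgen : ∀ φ : ↥Φ, ∃ n : ℤ, τΦ ^ n = φ := fun φ => by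
    obtain ⟨n, hn⟩ := Subgroup.mem_zpowers_iff.1 φ.2
    exact ⟨n, Subtype.ext (by rw [hτΦcoe, hn])⟩
  have hΦsmul : ∀ (φ : ↥Φ) (v : V), φ • v = (φ : Equiv.Perm V) v := fun _ _ => rfl
  have hpow : ∀ (n : ℤ) (v : V), (τΦ ^ n) • v = latticeGraphPerm σ ϖ ((StdForm.antidiagonal 3).over K) (eU τ ^ n) v := fun n v => by
    rw [hΦsmul, hτΦcoe, hpτ, ← latticeGraphPerm_zpow]
  have hexp : ∀ φ : ↥Φ, ∃ n : ℤ, ∀ v : V, φ • v = latticeGraphPerm σ ϖ ((StdForm.antidiagonal 3).over K) (eU τ ^ n) v := fun φ => by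
    obtain ⟨n, rfl⟩ := hgen φ
    exact ⟨n, hpow n⟩
  have hT := isTree_latticeGraph_three_of_unramified (K := K) hd
  have hadjΦ : ∀ (φ : ↥Φ) (a b : V), (latticeGraph σ ϖ ((StdForm.antidiagonal 3).over K)).Adj (φ • a) (φ • b) ↔
      (latticeGraph σ ϖ ((StdForm.antidiagonal 3).over K)).Adj a b := fun φ a b => by
    obtain ⟨n, hn⟩ := hexp φ
    rw [hn, hn]
    exact (latticeGraphIso σ ϖ ((StdForm.antidiagonal 3).over K) (eU τ ^ n)).map_rel_iff
  have hγadj : ∀ a b : V, (latticeGraph σ ϖ ((StdForm.antidiagonal 3).over K)).Adj (pγ a) (pγ b) ↔ (latticeGraph σ ϖ ((StdForm.antidiagonal 3).over K)).Adj a b :=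
    fun a b => (latticeGraphIso σ ϖ ((StdForm.antidiagonal 3).over K) (eU γ)).map_rel_iff
  -- `Φ` preserves types and commutes with `pγ`
  have hΦtype : ∀ (φ : ↥Φ) (v : V) (d : ℕ), IsVertexLattice σ ϖ ((StdForm.antidiagonal 3).over K) d (φ • v).1 ↔ IsVertexLattice σ ϖ ((StdForm.antidiagonal 3).over K) d v.1 :=
    fun φ v d => by
    obtain ⟨n, hn⟩ := hexp φ
    rw [hn, latticeGraphPerm_apply_coe]
    exact isVertexLattice_mapGL_iff σ ϖ _ (eU τ ^ n) v.1
  have hΦcomm : ∀ (φ : ↥Φ) (v : V), pγ (φ • v) = φ • pγ v := fun φ v => by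
    obtain ⟨n, hn⟩ := hexp φ
    have hzn : eU τ ^ n * eU γ = eU γ * eU τ ^ n := (Commute.zpow_left (show Commute (eU τ) (eU γ) from hτγ') n).eq
    rw [hn, hn, hpγ, ← Equiv.Perm.mul_apply, ← Equiv.Perm.mul_apply, ← latticeGraphPerm_mul, ← latticeGraphPerm_mul, hzn]
  /- the apartment `… L_a — L′_a — L_{a−1} — …` -/
  let vL : ℤ → V := fun a => ⟨latt (Matrix.diagonal ![ϖ ^ a, (1 : K), ϖ ^ (-a)]),
    ⟨0, isSelfDualLattice_latt_diagonal_zpow hd.σσ hd.σϖ (v_le_one_of_v_eq_exp_neg_one hd.vϖ) (uniformizer_ne_zero hd.vϖ) a⟩⟩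
  let vT : ℤ → V := fun a => ⟨latt (Matrix.diagonal ![ϖ ^ a, (1 : K), ϖ ^ (1 - a)]),
    ⟨2, isVertexLattice_two_latt_diagonal_zpow hd.σσ hd.σϖ (v_le_one_of_v_eq_exp_neg_one hd.vϖ) (uniformizer_ne_zero hd.vϖ) a⟩⟩
  have hadjTL : ∀ a : ℤ, (latticeGraph σ ϖ ((StdForm.antidiagonal 3).over K)).Adj (vT a) (vL a) := fun a =>
    latticeGraph_adj_apartment_two_selfDual hd.σσ hd.σϖ hd.vϖ a
  have hadjLT : ∀ a : ℤ, (latticeGraph σ ϖ ((StdForm.antidiagonal 3).over K)).Adj (vL a) (vT (a + 1)) := fun a =>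
    latticeGraph_adj_apartment_selfDual_two_succ hd.σσ hd.σϖ hd.vϖ a
  have hτm' : (((eU τ : ↥(unitaryGroupOfForm σ ((StdForm.antidiagonal 3).over K))) : GL (Fin 3) K) : Matrix (Fin 3) (Fin 3) K) = Matrix.diagonal ![ϖ ^ (-1 : ℤ), 1, ϖ ^ (-(-1 : ℤ))] := by
    rw [hτm, _root_.zpow_neg_one, neg_neg, zpow_one]
  have hτL : ∀ a : ℤ, τΦ • vL a = vL (a + -1) := fun a =>
    latticeGraphIso_apartment_selfDual_translate hd.σσ hd.σϖ hd.vϖ (eU τ) (-1) a hτm'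
  have hτT : ∀ a : ℤ, τΦ • vT a = vT (a + -1) := fun a =>
    latticeGraphIso_apartment_two_translate hd.σσ hd.σϖ hd.vϖ (eU τ) (-1) a hτm'
  have hpowL : ∀ (n a : ℤ), (τΦ ^ n) • vL a = vL (a - n) := fun n => by
    induction n using Int.induction_on with
    | zero => intro a; rw [zpow_zero, one_smul, sub_zero]
    | succ n ih => intro a; rw [_root_.zpow_add_one, mul_smul, hτL, ih, show a + -1 - (n : ℤ) = a - (n + 1) by ring]
    | pred n ih =>
      intro a
      have h1 : τΦ⁻¹ • vL a = vL (a + 1) := by rw [inv_smul_eq_iff, hτL, show a + 1 + -1 = a by ring]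
      rw [_root_.zpow_sub_one, mul_smul, h1, ih, show a + 1 - -(n : ℤ) = a - (-(n : ℤ) - 1) by ring]
  have hpowT : ∀ (n a : ℤ), (τΦ ^ n) • vT a = vT (a - n) := fun n => by
    induction n using Int.induction_on with
    | zero => intro a; rw [zpow_zero, one_smul, sub_zero]
    | succ n ih => intro a; rw [_root_.zpow_add_one, mul_smul, hτT, ih, show a + -1 - (n : ℤ) = a - (n + 1) by ring]
    | pred n ih =>
      intro a
      have h1 : τΦ⁻¹ • vT a = vT (a + 1) := by rw [inv_smul_eq_iff, hτT, show a + 1 + -1 = a by ring]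
      rw [_root_.zpow_sub_one, mul_smul, h1, ih, show a + 1 - -(n : ℤ) = a - (-(n : ℤ) - 1) by ring]
  -- injectivity along the apartment (valuations of the first and third diagonal entries)
  have hnzL : ∀ (a : ℤ) (i : Fin 3), (![ϖ ^ a, (1 : K), ϖ ^ (-a)]) i ≠ 0 := fun a i => by
    fin_cases i
    · exact zpow_ne_zero _ hϖ0
    · exact one_ne_zero
    · exact zpow_ne_zero _ hϖ0
  have hnzT : ∀ (a : ℤ) (i : Fin 3), (![ϖ ^ a, (1 : K), ϖ ^ (1 - a)]) i ≠ 0 := fun a i => by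
    fin_cases i
    · exact zpow_ne_zero _ hϖ0
    · exact one_ne_zero
    · exact zpow_ne_zero _ hϖ0
  have hLinj : ∀ a b : ℤ, vL a = vL b → a = b := fun a b hab => by
    have h := (latt_diagonal_le_latt_diagonal_iff (hnzL a) (hnzL b)).1 (le_of_eq (congrArg Subtype.val hab))
    have h0 := h 0
    have h2 := h 2
    change Valued.v (ϖ ^ a) ≤ Valued.v (ϖ ^ b) at h0
    change Valued.v (ϖ ^ (-a)) ≤ Valued.v (ϖ ^ (-b)) at h2
    rw [v_zpow_le_v_zpow_iff hd.vϖ] at h0 h2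
    omega
  have hTinj : ∀ a b : ℤ, vT a = vT b → a = b := fun a b hab => by
    have h := (latt_diagonal_le_latt_diagonal_iff (hnzT a) (hnzT b)).1 (le_of_eq (congrArg Subtype.val hab))
    have h0 := h 0
    have h2 := h 2
    change Valued.v (ϖ ^ a) ≤ Valued.v (ϖ ^ b) at h0
    change Valued.v (ϖ ^ (1 - a)) ≤ Valued.v (ϖ ^ (1 - b)) at h2
    rw [v_zpow_le_v_zpow_iff hd.vϖ] at h0 h2
    omega
  have hLT : ∀ a b : ℤ, vL a ≠ vT b := fun a b hab => by
    have h2 : IsVertexLattice σ ϖ ((StdForm.antidiagonal 3).over K) 2 (vL a).1 := by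
      rw [congrArg Subtype.val hab]
      exact isVertexLattice_two_latt_diagonal_zpow hd.σσ hd.σϖ hϖ1 hϖ0 b
    exact hnot _ h2 (isSelfDualLattice_latt_diagonal_zpow hd.σσ hd.σϖ hϖ1 hϖ0 a)
  /- the two-step line `W (2n) = L_{−n}`, `W (2n+1) = L′_{−n}` -/
  have h01 : (latticeGraph σ ϖ ((StdForm.antidiagonal 3).over K)).Adj (vL 0) (vT 0) := (hadjTL 0).symm
  have h1τ : (latticeGraph σ ϖ ((StdForm.antidiagonal 3).over K)).Adj (vT 0) (τΦ • vL 0) := by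
    rw [hτL, show (0 : ℤ) + -1 = -1 by norm_num]
    have h := hadjLT (-1)
    rw [show (-1 : ℤ) + 1 = 0 by norm_num] at h
    exact h.symm
  have hfree₀ : ∀ n : ℤ, τΦ ^ n • vL 0 = vL 0 → n = 0 := fun n hn => by
    rw [hpowL] at hn
    have := hLinj _ _ hn
    omega
  have hfree₁ : ∀ n : ℤ, τΦ ^ n • vT 0 = vT 0 → n = 0 := fun n hn => by
    rw [hpowT] at hn
    have := hTinj _ _ hn
    omega
  have hne : ∀ n : ℤ, τΦ ^ n • vL 0 ≠ vT 0 := fun n hn => by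
    rw [hpowL] at hn
    exact hLT _ _ hn
  obtain ⟨W, hWinj, hWadj, hW, hW0, hW1⟩ := TreeAction.exists_line_of_two_step hadjΦ τΦ (vL 0) (vT 0) h01 h1τ hfree₀ hfree₁ hne
  have hW2 : ∀ n : ℤ, W (n * 2) = vL (-n) := fun n => by
    have h := TreeAction.zpow_smul_line τΦ W hW n 0
    rw [hW0, hpowL, zero_add, zero_sub] at h
    exact h.symm
  have hW2' : ∀ n : ℤ, W (n * 2 + 1) = vT (-n) := fun n => by
    have h := TreeAction.zpow_smul_line τΦ W hW n 1
    rw [hW1, hpowT, zero_sub, add_comm (1 : ℤ)] at h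
    exact h.symm
  -- `γ` shifts the apartment by `c`, hence translates the line by `−2c`
  have hγL : ∀ a : ℤ, pγ (vL a) = vL (a + c) := fun a =>
    Subtype.ext (mapGL_latt_apartment_selfDual_of_diagonal hd.vϖ (eU γ) hγm he₀ he₁ he₂ a)
  have hγT : ∀ a : ℤ, pγ (vT a) = vT (a + c) := fun a =>
    Subtype.ext (mapGL_latt_apartment_two_of_diagonal hd.vϖ (eU γ) hγm he₀ he₁ he₂ a)
  have hγW : ∃ j : ℤ, ∀ k : ℤ, pγ (W k) = W (k + j) := by
    refine ⟨-(2 * c), fun k => ?_⟩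
    obtain ⟨n, rfl | rfl⟩ := Int.even_or_odd' k
    · rw [show (2 : ℤ) * n = n * 2 by ring, hW2, hγL, show n * 2 + -(2 * c) = (n - c) * 2 by ring, hW2]
      exact congrArg vL (by ring)
    · rw [show (2 : ℤ) * n + 1 = n * 2 + 1 by ring, hW2', hγT, show n * 2 + 1 + -(2 * c) = (n - c) * 2 + 1 by ring, hW2']
      exact congrArg vT (by ring)
  /- «fixed vertices = pointwise-fixed edges» per period (★ TREE SIDE) -/
  have hVE := TreeAction.natCard_quotient_fixed_vertices_eq_fixed_edges_of_line_of_exists hT hadjΦ τΦ hgen W hWinj hWadj hW pγ hγadj hγW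
  -- the fixed vertices split by type
  have hunion : {v : V | pγ v = v} =
      {v : V | latticeGraphIso σ ϖ ((StdForm.antidiagonal 3).over K) (eU γ) v = v ∧ IsSelfDualLattice σ ϖ ((StdForm.antidiagonal 3).over K) v.1} ∪
        {v : V | latticeGraphIso σ ϖ ((StdForm.antidiagonal 3).over K) (eU γ) v = v ∧ IsVertexLattice σ ϖ ((StdForm.antidiagonal 3).over K) 2 v.1} := by
    ext v
    simp only [Set.mem_setOf_eq, Set.mem_union]
    constructor
    · intro h
      obtain ⟨d, hvd⟩ := v.2
      rcases type_eq_zero_or_two_of_isVertexLattice_three hd.vσ hd.vϖ v_det_antidiagonal_three hvd with rfl | rfl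
      · exact Or.inl ⟨h, hvd⟩
      · exact Or.inr ⟨h, hvd⟩
    · rintro (⟨h, -⟩ | ⟨h, -⟩) <;> exact h
  have hdisj : Disjoint {v : V | latticeGraphIso σ ϖ ((StdForm.antidiagonal 3).over K) (eU γ) v = v ∧ IsSelfDualLattice σ ϖ ((StdForm.antidiagonal 3).over K) v.1}
      {v : V | latticeGraphIso σ ϖ ((StdForm.antidiagonal 3).over K) (eU γ) v = v ∧ IsVertexLattice σ ϖ ((StdForm.antidiagonal 3).over K) 2 v.1} :=
    Set.disjoint_left.2 fun v hvA hvB => hnot _ hvB.2 hvA.2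
  have hinvA : ∀ (φ : ↥Φ) (v : V), v ∈ {v : V | latticeGraphIso σ ϖ ((StdForm.antidiagonal 3).over K) (eU γ) v = v ∧ IsSelfDualLattice σ ϖ ((StdForm.antidiagonal 3).over K) v.1} →
      φ • v ∈ {v : V | latticeGraphIso σ ϖ ((StdForm.antidiagonal 3).over K) (eU γ) v = v ∧ IsSelfDualLattice σ ϖ ((StdForm.antidiagonal 3).over K) v.1} := fun φ v hv => by
    refine ⟨?_, (hΦtype φ v 0).2 hv.2⟩
    change pγ (φ • v) = φ • v
    rw [hΦcomm, show pγ v = v from hv.1]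
  obtain ⟨-, hsum⟩ := natCard_quotient_orbitRel_comap_union (Φ := ↥Φ) _ _ hdisj hinvA hfinA' hfinB'
  rw [hunion] at hVE
  -- the pointwise-fixed edges are the fixed flags, equivariantly
  have hIE : Nat.card (Quotient ((orbitRel ↥Φ (V × V)).comap
      (Subtype.val : {p : V × V // IsSelfDualLattice σ ϖ ((StdForm.antidiagonal 3).over K) p.1.1 ∧ IsVertexLattice σ ϖ ((StdForm.antidiagonal 3).over K) 2 p.2.1 ∧ p.2.1 < p.1.1 ∧
        latticeGraphIso σ ϖ ((StdForm.antidiagonal 3).over K) (eU γ) p.1 = p.1 ∧ latticeGraphIso σ ϖ ((StdForm.antidiagonal 3).over K) (eU γ) p.2 = p.2} → V × V))) =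
      Nat.card (Quotient ((orbitRel ↥Φ (Set V)).comap
        (Subtype.val : ↥{t : Set V | ∃ a b : V, (latticeGraph σ ϖ ((StdForm.antidiagonal 3).over K)).Adj a b ∧ t = {a, b} ∧ pγ a = a ∧ pγ b = b} → Set V))) := by
    refine (natCard_quotient_orbitRel_comap_eq_of_bijective (Φ := ↥Φ)
      {p : V × V | IsSelfDualLattice σ ϖ ((StdForm.antidiagonal 3).over K) p.1.1 ∧ IsVertexLattice σ ϖ ((StdForm.antidiagonal 3).over K) 2 p.2.1 ∧ p.2.1 < p.1.1 ∧
        latticeGraphIso σ ϖ ((StdForm.antidiagonal 3).over K) (eU γ) p.1 = p.1 ∧ latticeGraphIso σ ϖ ((StdForm.antidiagonal 3).over K) (eU γ) p.2 = p.2}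
      {t : Set V | ∃ a b : V, (latticeGraph σ ϖ ((StdForm.antidiagonal 3).over K)).Adj a b ∧ t = {a, b} ∧ pγ a = a ∧ pγ b = b}
      (fun p => ⟨{(p : V × V).1, (p : V × V).2}, (p : V × V).1, (p : V × V).2, (latticeGraph_adj_iff σ ϖ ((StdForm.antidiagonal 3).over K) _ _).2 (Or.inr p.2.2.2.1), rfl,
        p.2.2.2.2.1, p.2.2.2.2.2⟩) ⟨?_, ?_⟩ fun q t => ⟨?_, ?_⟩).1
    · intro p q hpq
      have h : ({(p : V × V).1, (p : V × V).2} : Set V) = {(q : V × V).1, (q : V × V).2} := congrArg Subtype.val hpq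
      rw [Set.pair_eq_pair_iff] at h
      rcases h with ⟨h1, h2⟩ | ⟨h1, h2⟩
      · exact Subtype.ext (Prod.ext h1 h2)
      · exact (hnot _ (by rw [h1]; exact q.2.2.1) p.2.1).elim
    · rintro ⟨t, a, b, hab, rfl, hγa, hγb⟩
      rw [latticeGraph_adj_iff] at hab
      obtain ⟨da, ha⟩ := a.2
      obtain ⟨db, hb⟩ := b.2
      rcases hab with hlt | hlt
      · have ht := type_of_lt_three hd.vσ hd.vϖ v_det_antidiagonal_three ha hb hlt
        rw [ht.1] at ha
        rw [ht.2] at hb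
        refine ⟨⟨(b, a), hb, ha, hlt, hγb, hγa⟩, Subtype.ext ?_⟩
        exact Set.pair_comm _ _
      · have ht := type_of_lt_three hd.vσ hd.vϖ v_det_antidiagonal_three hb ha hlt
        rw [ht.1] at hb
        rw [ht.2] at ha
        exact ⟨⟨(a, b), ha, hb, hlt, hγa, hγb⟩, rfl⟩
    · rintro ⟨φ, hφ⟩
      refine ⟨φ, ?_⟩
      change φ • ({(t : V × V).1, (t : V × V).2} : Set V) = {(q : V × V).1, (q : V × V).2}
      rw [Set.smul_set_insert, Set.smul_set_singleton, ← Prod.smul_fst, ← Prod.smul_snd, hφ]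
    · rintro ⟨φ, hφ⟩
      refine ⟨φ, ?_⟩
      have h : ({φ • (t : V × V).1, φ • (t : V × V).2} : Set V) = {(q : V × V).1, (q : V × V).2} := by
        rw [← Set.smul_set_singleton, ← Set.smul_set_insert]; exact hφ
      rw [Set.pair_eq_pair_iff] at h
      rcases h with ⟨h1, h2⟩ | ⟨h1, -⟩
      · exact Prod.ext (by rw [Prod.smul_fst, h1]) (by rw [Prod.smul_snd, h2])
      · exact (hnot _ q.2.2.1 (by rw [← h1]; exact (hΦtype φ _ 0).2 t.2.1)).elim
  rw [← hsum, hVE, hIE]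

end Relation

end Literature.NumberTheory.Automorphic.UnitaryLatticeTree

end
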